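import Mathlib.Data.Finset.Powerset
import Mathlib.Data.Nat.Choose.Basic
import Mathlib.Analysis.SpecialFunctions.Log.Basic
import Literature.Computability.Complexity.RossmanMonotoneClique
import Literature.Computability.Complexity.Rossman2008CliqueProofs
import Literature.Computability.Complexity.RossmanMonotoneCliqueProb
import HarnessLib

/-!
# Small and medium graphs: Rossman's classes `I` and `J`; exponent bookkeeping (Rossman 2010, §5–§6)

Graph combinatorics on the edge vectors `x : E(Kₙ) → Bool` of `RossmanMonotoneClique.lean`
(`E(Kₙ) = (⊤ : SimpleGraph (Fin n)).edgeSet`) needed for Theorem 1, in two parts.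

**Graphs** (this part):

* `endpts e` (the two endpoints of a potential edge), `supp x` — the set of non-isolated
  vertices of the graph `x` (Rossman 2010, §2, `supp(G)`), `supp_sup`, `supp_mono`,
  `le_cliqueVec_iff : x ⊆ K_A ↔ supp x ⊆ A`, `supp_cliqueVec`;
* `card_onSet_le_choose : |E(x)| ≤ C(|supp x|, 2)` and the two-set refinement
  `card_onSet_sup_le` (`|E(x ∪ y)| + C(|supp x ∩ supp y|, 2) ≤ C(|supp x|,2) + C(|supp y|,2)`);
* `smallI k`, `medJ k` — the classes `I = {H : supp(H) < k/2}` and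
  `J = {H₁ ∪ H₂ : Hᵢ ∈ I} \ I` (§5, p. 6), with: single edges lie in `I` (`k ≥ 5`), `I ∪ I ⊆ I ∪ J`,
  `I ∪ J` is closed under subgraphs, and the numerical signature of `J`
  (`medJ_ineq : 4(k-1)·supp(H) - 8·|E(H)| ≥ k² + 7`, the "straightforward argument" at the end
  of §6, p. 9, that `supp(H) - (2/(k-1))|E_H|` is minimised over `J` by a `⌈k/2⌉`-clique minus an
  edge; proved here by a sum-of-squares identity in slack variables);
* `card_smallI_union_medJ_le : |I ∪ J| ≤ C(n,k) · 2^{C(k,2)}` (`n ≥ k`; Lemma 10's `n^{O(1)}`);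
* `kSubsetProb_supset_le : Pr_A[S ⊆ A] ≤ (k/n)^{|S|}` for the uniform `k`-set `A` (Lemma 16's
  "`O(n^{k - supp(Fᵢ)})` different `A`"), and the bridge `gnpProb_filter_eq_prob`.

**Exponent bookkeeping** (second part, see its section docstring): the constants `pMinus`,
`tThr`, `slack`, `cExp`, `cPrime`, `kappa`, `kappaP` of the proof as functions of `(k, δ)` and
the two exponent comparisons `kappaP_mul_add_le` (Lemma 15) and `kappa_mul_sub_le` (end of §6).

## References

* B. Rossman, *The monotone complexity of k-clique on random graphs*, FOCS 2010 (full version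
  2009), §2, §3 (p. 4), §5 (p. 6), §6 (p. 9) [Rossman2010].
-/

noncomputable section

namespace Literature.Computability.Complexity

open Finset

variable {n : ℕ}

/-! ### Endpoints, supports -/

/-- The two endpoints of a potential edge of `Kₙ`, as a `Finset`. [folklore] -/
def endpts (e : (⊤ : SimpleGraph (Fin n)).edgeSet) : Finset (Fin n) :=
  univ.filter fun v => v ∈ (e : Sym2 (Fin n))

/-- Membership in `endpts`. [folklore] -/
@[simp] theorem mem_endpts (e : (⊤ : SimpleGraph (Fin n)).edgeSet) (v : Fin n) :
    v ∈ endpts e ↔ v ∈ (e : Sym2 (Fin n)) := by simp [endpts]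

/-- A potential edge has exactly two endpoints. [folklore] -/
theorem card_endpts (e : (⊤ : SimpleGraph (Fin n)).edgeSet) : #(endpts e) = 2 := by
  obtain ⟨e, he⟩ := e
  induction e using Sym2.ind with
  | h u v =>
    have huv : u ≠ v := by simpa using he
    have : endpts ⟨s(u, v), he⟩ = {u, v} := by ext w; simp [endpts]
    rw [this, card_pair huv]

/-- `endpts` is injective (an unordered pair is determined by its members). [folklore] -/
theorem endpts_injective : Function.Injective (endpts : (⊤ : SimpleGraph (Fin n)).edgeSet → _) := by
  intro e e' h
  apply Subtype.ext
  refine Sym2.ext fun w => ?_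
  have := congrArg (w ∈ ·) h
  simpa using this

/-- `supp(G)`: the set of non-isolated vertices of the graph with edge vector `x`
(Rossman 2010, §2). [cite: Rossman2010, §2 (p. 3)] -/
def supp (x : (⊤ : SimpleGraph (Fin n)).edgeSet → Bool) : Finset (Fin n) :=
  univ.filter fun v => ∃ e, x e = true ∧ v ∈ (e : Sym2 (Fin n))

/-- Membership in the support. [folklore] -/
@[simp] theorem mem_supp (x : (⊤ : SimpleGraph (Fin n)).edgeSet → Bool) (v : Fin n) :
    v ∈ supp x ↔ ∃ e, x e = true ∧ v ∈ (e : Sym2 (Fin n)) := by simp [supp]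

/-- The support is the union of the endpoint sets of the on-edges. [folklore] -/
theorem supp_eq_biUnion (x : (⊤ : SimpleGraph (Fin n)).edgeSet → Bool) :
    supp x = (onSet x).biUnion endpts := by
  ext v; simp

/-- Endpoints of an on-edge are in the support. [folklore] -/
theorem endpts_subset_supp {x : (⊤ : SimpleGraph (Fin n)).edgeSet → Bool}
    {e : (⊤ : SimpleGraph (Fin n)).edgeSet} (he : x e = true) : endpts e ⊆ supp x := by
  intro v hv; rw [mem_supp]; exact ⟨e, he, (mem_endpts e v).1 hv⟩

/-- `supp` is monotone. [folklore] -/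
theorem supp_mono {x y : (⊤ : SimpleGraph (Fin n)).edgeSet → Bool} (h : x ≤ y) : supp x ⊆ supp y := by
  intro v hv
  rw [mem_supp] at hv ⊢
  obtain ⟨e, he, hv⟩ := hv
  have := h e; rw [he] at this
  exact ⟨e, top_le_iff.1 this, hv⟩

/-- `supp (x ∪ y) = supp x ∪ supp y`. [folklore] -/
@[simp] theorem supp_sup (x y : (⊤ : SimpleGraph (Fin n)).edgeSet → Bool) :
    supp (x ⊔ y) = supp x ∪ supp y := by
  ext v
  simp only [mem_supp, mem_union, Pi.sup_apply]
  constructor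
  · rintro ⟨e, he, hv⟩
    change (x e || y e) = true at he
    rw [Bool.or_eq_true] at he
    rcases he with he | he
    · exact Or.inl ⟨e, he, hv⟩
    · exact Or.inr ⟨e, he, hv⟩
  · rintro (⟨e, he, hv⟩ | ⟨e, he, hv⟩)
    · exact ⟨e, by change (x e || y e) = true; simp [he], hv⟩
    · exact ⟨e, by change (x e || y e) = true; simp [he], hv⟩

/-- The support of a single edge is its pair of endpoints. [folklore] -/
theorem supp_indVec_singleton (e : (⊤ : SimpleGraph (Fin n)).edgeSet) :
    supp (indVec {e}) = endpts e := by
  rw [supp_eq_biUnion, onSet_indVec, singleton_biUnion]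

/-- An edge of the clique vector `K_A` has both endpoints in `A` (definitional unfolding).
[folklore] -/
theorem cliqueVec_eq_true_iff_endpts (A : Finset (Fin n)) (e : (⊤ : SimpleGraph (Fin n)).edgeSet) :
    cliqueVec A e = true ↔ endpts e ⊆ A := by
  simp [cliqueVec, Finset.subset_iff]

/-- **`x ⊆ K_A ↔ supp x ⊆ A`**: a graph lies inside the clique on `A` iff all its non-isolated
vertices lie in `A`. [folklore] -/
theorem le_cliqueVec_iff (x : (⊤ : SimpleGraph (Fin n)).edgeSet → Bool) (A : Finset (Fin n)) :
    x ≤ cliqueVec A ↔ supp x ⊆ A := by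
  constructor
  · intro h v hv
    rw [mem_supp] at hv
    obtain ⟨e, he, hv⟩ := hv
    have h1 := h e
    rw [he] at h1
    exact (cliqueVec_eq_true_iff_endpts A e).1 (top_le_iff.1 h1) ((mem_endpts e v).2 hv)
  · intro h e
    rw [Bool.le_iff_imp]
    intro he
    exact (cliqueVec_eq_true_iff_endpts A e).2 ((endpts_subset_supp he).trans h)

/-- The support of `K_A` is inside `A`. [folklore] -/
theorem supp_cliqueVec_subset (A : Finset (Fin n)) : supp (cliqueVec A) ⊆ A :=
  (le_cliqueVec_iff _ A).1 le_rfl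

/-- The support of `K_A` is all of `A` as soon as `|A| ≥ 2`. [folklore] -/
theorem supp_cliqueVec {A : Finset (Fin n)} (hA : 2 ≤ #A) : supp (cliqueVec A) = A := by
  refine Subset.antisymm (supp_cliqueVec_subset A) fun u hu => ?_
  obtain ⟨v, hv, hvu⟩ : ∃ v ∈ A, v ≠ u := by
    by_contra h
    push Not at h
    have : A ⊆ {u} := fun w hw => mem_singleton.2 (h w hw)
    have := card_le_card this
    rw [card_singleton] at this
    omega
  have he : s(u, v) ∈ (⊤ : SimpleGraph (Fin n)).edgeSet := by simpa using hvu.symm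
  rw [mem_supp]
  refine ⟨⟨s(u, v), he⟩, (cliqueVec_eq_true_iff_endpts A _).2 ?_, Sym2.mem_mk_left u v⟩
  intro w hw
  simp only [mem_endpts, Sym2.mem_iff] at hw
  rcases hw with rfl | rfl
  · exact hu
  · exact hv

/-! ### Edge counts versus support sizes -/

/-- The on-edges of `x` are 2-subsets of `supp x`; more generally of any `S ⊇ supp x`.
[folklore] -/
theorem endpts_mem_powersetCard {x : (⊤ : SimpleGraph (Fin n)).edgeSet → Bool} {S : Finset (Fin n)}
    (hS : supp x ⊆ S) {e : (⊤ : SimpleGraph (Fin n)).edgeSet} (he : e ∈ onSet x) :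
    endpts e ∈ S.powersetCard 2 := by
  rw [mem_powersetCard]
  exact ⟨(endpts_subset_supp ((mem_onSet x e).1 he)).trans hS, card_endpts e⟩

/-- **`|E(x)| ≤ C(|S|, 2)`** whenever `supp x ⊆ S`. [folklore] -/
theorem card_onSet_le_choose_of_supp_subset {x : (⊤ : SimpleGraph (Fin n)).edgeSet → Bool}
    {S : Finset (Fin n)} (hS : supp x ⊆ S) : #(onSet x) ≤ (#S).choose 2 := by
  rw [← card_powersetCard 2 S]
  exact card_le_card_of_injOn endpts (fun e he => endpts_mem_powersetCard hS he)
    (endpts_injective.injOn)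

/-- `|E(x)| ≤ C(|supp x|, 2)`. [folklore] -/
theorem card_onSet_le_choose (x : (⊤ : SimpleGraph (Fin n)).edgeSet → Bool) :
    #(onSet x) ≤ (#(supp x)).choose 2 :=
  card_onSet_le_choose_of_supp_subset Subset.rfl

/-- 2-subsets of `S` and of `T` in common are the 2-subsets of `S ∩ T`. [folklore] -/
theorem powersetCard_inter (m : ℕ) (S T : Finset (Fin n)) :
    S.powersetCard m ∩ T.powersetCard m = (S ∩ T).powersetCard m := by
  ext U
  simp only [mem_inter, mem_powersetCard, subset_inter_iff]
  tauto

/-- **Edges of a union of two graphs** are 2-subsets of one of the two supports, hence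
`|E(x ∪ y)| + C(|supp x ∩ supp y|, 2) ≤ C(|supp x|, 2) + C(|supp y|, 2)`. [folklore] -/
theorem card_onSet_sup_le (x y : (⊤ : SimpleGraph (Fin n)).edgeSet → Bool) :
    #(onSet (x ⊔ y)) + (#(supp x ∩ supp y)).choose 2 ≤
      (#(supp x)).choose 2 + (#(supp y)).choose 2 := by
  have h1 : #(onSet (x ⊔ y)) ≤ #((supp x).powersetCard 2 ∪ (supp y).powersetCard 2) := by
    refine card_le_card_of_injOn endpts (fun e he => ?_) endpts_injective.injOn
    rw [mem_coe, onSet_sup, mem_union] at he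
    rw [mem_coe, mem_union]
    rcases he with he | he
    · exact Or.inl (endpts_mem_powersetCard Subset.rfl he)
    · exact Or.inr (endpts_mem_powersetCard Subset.rfl he)
  have h2 := card_union_add_card_inter ((supp x).powersetCard 2) ((supp y).powersetCard 2)
  rw [powersetCard_inter, card_powersetCard, card_powersetCard, card_powersetCard] at h2
  omega

/-! ### The classes `I` and `J` -/

/-- **`I`**: the graphs with fewer than `k/2` non-isolated vertices (Rossman 2010, §5:
`I = {H : supp(H) < k/2}`). [cite: Rossman2010, §5 (p. 6)] -/
def smallI (n k : ℕ) : Finset ((⊤ : SimpleGraph (Fin n)).edgeSet → Bool) :=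
  univ.filter fun x => 2 * #(supp x) < k

/-- **`J`**: unions of two graphs of `I` which are not themselves in `I` (Rossman 2010, §5:
`J = {H₁ ∪ H₂ : H₁, H₂ ∈ I} \ I`). [cite: Rossman2010, §5 (p. 6)] -/
def medJ (n k : ℕ) : Finset ((⊤ : SimpleGraph (Fin n)).edgeSet → Bool) :=
  univ.filter fun z => z ∉ smallI n k ∧ ∃ x ∈ smallI n k, ∃ y ∈ smallI n k, z = x ⊔ y

/-- Membership in `I`. [folklore] -/
theorem mem_smallI {k : ℕ} (x : (⊤ : SimpleGraph (Fin n)).edgeSet → Bool) :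
    x ∈ smallI n k ↔ 2 * #(supp x) < k := by simp [smallI]

/-- Membership in `J`. [folklore] -/
theorem mem_medJ {k : ℕ} (z : (⊤ : SimpleGraph (Fin n)).edgeSet → Bool) :
    z ∈ medJ n k ↔ ¬ 2 * #(supp z) < k ∧ ∃ x ∈ smallI n k, ∃ y ∈ smallI n k, z = x ⊔ y := by
  simp [medJ, mem_smallI]

/-- `I` is closed under subgraphs. [folklore] -/
theorem mem_smallI_of_le {k : ℕ} {x y : (⊤ : SimpleGraph (Fin n)).edgeSet → Bool} (hy : y ∈ smallI n k)
    (h : x ≤ y) : x ∈ smallI n k := by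
  rw [mem_smallI] at hy ⊢
  exact lt_of_le_of_lt (Nat.mul_le_mul_left 2 (card_le_card (supp_mono h))) hy

/-- **Single edges are in `I`** for `k ≥ 5` (Rossman 2010, proof of Lemma 14: "the graph whose
only edge is `e` has only 2 non-isolated vertices (and `2 < k/2` as `k ≥ 5`)").
[cite: Rossman2010, Lemma 14 (p. 8)] -/
theorem indVec_singleton_mem_smallI {k : ℕ} (hk : 5 ≤ k) (e : (⊤ : SimpleGraph (Fin n)).edgeSet) :
    indVec {e} ∈ smallI n k := by
  rw [mem_smallI, supp_indVec_singleton, card_endpts]; omega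

/-- **`I ∪ I ⊆ I ∪ J`** (Rossman 2010, Observation 7: "if `M(f), M(g) ⊆ I` then
`M(f ∧ g) ⊆ I ∪ J`"). [cite: Rossman2010, Observation 7 (p. 6)] -/
theorem sup_mem_smallI_union_medJ {k : ℕ} {x y : (⊤ : SimpleGraph (Fin n)).edgeSet → Bool}
    (hx : x ∈ smallI n k) (hy : y ∈ smallI n k) : x ⊔ y ∈ smallI n k ∪ medJ n k := by
  rw [mem_union]
  by_cases h : x ⊔ y ∈ smallI n k
  · exact Or.inl h
  · refine Or.inr ((mem_medJ _).2 ⟨fun h' => h ((mem_smallI _).2 h'), x, hx, y, hy, rfl⟩)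

/-- **`I ∪ J` is closed under subgraphs** (`S(I ∪ J) = I ∪ J`, used in the proof of Lemma 9:
the core `H₀ ⊆ H' ∈ I ∪ J` is again in `I ∪ J`). [cite: Rossman2010, Lemma 9 (p. 7)] -/
theorem mem_smallI_union_medJ_of_le {k : ℕ} {x y : (⊤ : SimpleGraph (Fin n)).edgeSet → Bool}
    (hy : y ∈ smallI n k ∪ medJ n k) (h : x ≤ y) : x ∈ smallI n k ∪ medJ n k := by
  rw [mem_union] at hy
  rcases hy with hy | hy
  · exact mem_union_left _ (mem_smallI_of_le hy h)
  · obtain ⟨-, a, ha, b, hb, rfl⟩ := (mem_medJ _).1 hy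
    have : x = (x ⊓ a) ⊔ (x ⊓ b) := by rw [← inf_sup_left, inf_eq_left.2 h]
    rw [this]
    exact sup_mem_smallI_union_medJ (mem_smallI_of_le ha inf_le_right) (mem_smallI_of_le hb inf_le_right)

/-- `2·C(a,2) + a = a²`. [folklore] -/
theorem two_mul_choose_two_add (a : ℕ) : 2 * a.choose 2 + a = a * a := by
  induction a with
  | zero => simp
  | succ a ih =>
    rw [Nat.choose_succ_succ, Nat.choose_one_right]
    nlinarith [ih]

/-- **The numerical signature of `J`**: every `H ∈ J` has `v = supp(H)` non-isolated vertices
and `s = |E_H|` edges with `1 ≤ s`, `v ≤ k - 1`, and `4(k-1)v - 8s ≥ k² + 7` (written without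
subtraction); the last inequality is Rossman's "straightforward argument" (end of §6, p. 9) that
`supp(H) - (2/(k-1))|E_H|` over `H ∈ J` is minimal for a `⌈k/2⌉`-clique minus an edge, where it
equals `(k+1)/4 + 9/(4(k-1))` (`k` even) resp. `(k+1)/4 + 2/(k-1)` (`k` odd), both
`≥ (k² + 7)/(4(k-1))`; proved by a sum-of-squares identity in the slack variables
`m - supp(H₁)`, `m - supp(H₂)`, `supp(H) - m - 1` (`m = ⌈k/2⌉ - 1`). [cite: Rossman2010, §6 (p. 9)] -/
theorem medJ_ineq {k : ℕ} {z : (⊤ : SimpleGraph (Fin n)).edgeSet → Bool} (hz : z ∈ medJ n k) :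
    1 ≤ #(onSet z) ∧ #(supp z) + 1 ≤ k ∧
      k ^ 2 + 7 + 8 * #(onSet z) + 4 * #(supp z) ≤ 4 * k * #(supp z) := by
  obtain ⟨hzI, x, hx, y, hy, rfl⟩ := (mem_medJ _).1 hz
  rw [mem_smallI] at hx hy
  have hE := card_onSet_sup_le x y
  have hv := card_union_add_card_inter (supp x) (supp y)
  rw [supp_sup] at hzI ⊢
  have hs1 : 1 ≤ #(onSet (x ⊔ y)) := by
    rw [Nat.one_le_iff_ne_zero]
    intro hs0
    have : supp (x ⊔ y) = ∅ := by
      rw [supp_eq_biUnion, card_eq_zero.1 hs0, biUnion_empty]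
    rw [supp_sup] at this
    rw [this, card_empty] at hzI
    omega
  have hta : #(supp x ∩ supp y) ≤ #(supp x) := card_le_card inter_subset_left
  refine ⟨hs1, by omega, ?_⟩
  obtain ⟨m, hkm⟩ : ∃ m, k = 2 * m + 1 ∨ k = 2 * m + 2 := ⟨(k - 1) / 2, by omega⟩
  have ham : #(supp x) ≤ m := by omega
  have hbm : #(supp y) ≤ m := by omega
  have hvm : m + 1 ≤ #(supp x ∪ supp y) := by omega
  have hca := two_mul_choose_two_add #(supp x)
  have hcb := two_mul_choose_two_add #(supp y)
  have hct := two_mul_choose_two_add #(supp x ∩ supp y)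
  zify at hE hv ham hbm hvm hca hcb hct ⊢
  have ht : ((#(supp x ∩ supp y) : ℕ) : ℤ) = #(supp x) + #(supp y) - #(supp x ∪ supp y) := by
    linarith
  rw [ht] at hct
  have h0a := sub_nonneg.2 ham
  have h0b := sub_nonneg.2 hbm
  have h0v : (0 : ℤ) ≤ #(supp x ∪ supp y) - m - 1 := by linarith
  rcases hkm with rfl | rfl
  · push_cast at hvm ⊢
    nlinarith [mul_nonneg h0a h0b, mul_nonneg h0a h0v, mul_nonneg h0b h0v, mul_nonneg h0v h0v]
  · push_cast at hvm ⊢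
    nlinarith [mul_nonneg h0a h0b, mul_nonneg h0a h0v, mul_nonneg h0b h0v, mul_nonneg h0v h0v]

/-! ### Counting small graphs -/

/-- The potential edges inside a vertex set `S`. [folklore] -/
def edgesIn (S : Finset (Fin n)) : Finset ((⊤ : SimpleGraph (Fin n)).edgeSet) :=
  univ.filter fun e => endpts e ⊆ S

/-- There are at most `C(|S|, 2)` potential edges inside `S`. [folklore] -/
theorem card_edgesIn_le (S : Finset (Fin n)) : #(edgesIn S) ≤ (#S).choose 2 := by
  rw [← card_powersetCard 2 S]
  refine card_le_card_of_injOn endpts (fun e he => ?_) endpts_injective.injOn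
  rw [mem_coe, edgesIn, mem_filter] at he
  rw [mem_coe, mem_powersetCard]
  exact ⟨he.2, card_endpts e⟩

/-- At most `2^{C(|S|,2)}` graphs have all their non-isolated vertices in `S`. [folklore] -/
theorem card_filter_supp_subset_le (S : Finset (Fin n)) :
    #(univ.filter fun x : (⊤ : SimpleGraph (Fin n)).edgeSet → Bool => supp x ⊆ S) ≤
      2 ^ (#S).choose 2 := by
  calc #(univ.filter fun x : (⊤ : SimpleGraph (Fin n)).edgeSet → Bool => supp x ⊆ S)
      ≤ #((edgesIn S).powerset) := by
        refine card_le_card_of_injOn onSet (fun x hx => ?_) onSet_injective.injOn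
        rw [mem_coe, mem_filter] at hx
        rw [mem_coe, mem_powerset]
        intro e he
        rw [edgesIn, mem_filter]
        exact ⟨mem_univ _, (endpts_subset_supp ((mem_onSet x e).1 he)).trans hx.2⟩
    _ = 2 ^ #(edgesIn S) := card_powerset _
    _ ≤ 2 ^ (#S).choose 2 := Nat.pow_le_pow_right (by norm_num) (card_edgesIn_le S)

/-- **Few small graphs**: for `k ≤ n`, at most `C(n,k) · 2^{C(k,2)}` graphs on `[n]` have at most
`k` non-isolated vertices (the bound `|I ∪ J| ≤ n^{O(1)}` of Rossman 2010, Lemma 10).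
[cite: Rossman2010, Lemma 10 (p. 7)] -/
theorem card_filter_card_supp_le {k : ℕ} (hkn : k ≤ n) :
    #(univ.filter fun x : (⊤ : SimpleGraph (Fin n)).edgeSet → Bool => #(supp x) ≤ k) ≤
      n.choose k * 2 ^ k.choose 2 := by
  have hcov : (univ.filter fun x : (⊤ : SimpleGraph (Fin n)).edgeSet → Bool => #(supp x) ≤ k) ⊆
      (powersetCard k (univ : Finset (Fin n))).biUnion fun S => univ.filter fun x => supp x ⊆ S := by
    intro x hx
    rw [mem_filter] at hx
    obtain ⟨S, hxS, -, hS⟩ := exists_subsuperset_card_eq (subset_univ (supp x)) hx.2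
      (by rwa [card_univ, Fintype.card_fin])
    rw [mem_biUnion]
    exact ⟨S, mem_powersetCard.2 ⟨subset_univ _, hS⟩, mem_filter.2 ⟨mem_univ _, hxS⟩⟩
  refine (card_le_card hcov).trans (card_biUnion_le.trans ?_)
  calc ∑ S ∈ powersetCard k (univ : Finset (Fin n)), #(univ.filter fun x => supp x ⊆ S)
      ≤ ∑ S ∈ powersetCard k (univ : Finset (Fin n)), 2 ^ k.choose 2 := by
        refine sum_le_sum fun S hS => ?_
        rw [(mem_powersetCard.1 hS).2.symm]
        exact card_filter_supp_subset_le S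
    _ = n.choose k * 2 ^ k.choose 2 := by rw [sum_const, card_powersetCard, card_univ, Fintype.card_fin, smul_eq_mul]

/-- `|I ∪ J| ≤ C(n,k) · 2^{C(k,2)}` for `k ≤ n`: every graph in `I ∪ J` has fewer than `k`
non-isolated vertices. [cite: Rossman2010, Lemma 10 (p. 7)] -/
theorem card_smallI_union_medJ_le {k : ℕ} (hkn : k ≤ n) :
    #(smallI n k ∪ medJ n k) ≤ n.choose k * 2 ^ k.choose 2 := by
  refine le_trans (card_le_card fun z hz => ?_) (card_filter_card_supp_le hkn)
  rw [mem_filter]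
  refine ⟨mem_univ _, ?_⟩
  rw [mem_union] at hz
  rcases hz with hz | hz
  · rw [mem_smallI] at hz; omega
  · exact (by have := (medJ_ineq hz).2.1; omega)

/-! ### The uniformly random `k`-set -/

/-- `kSubsetProb` is monotone in the event. [folklore] -/
theorem kSubsetProb_mono {k : ℕ} {P Q : Finset (Fin n) → Prop} [DecidablePred P] [DecidablePred Q]
    (h : ∀ A, P A → Q A) : kSubsetProb n k P ≤ kSubsetProb n k Q := by
  unfold kSubsetProb
  refine div_le_div_of_nonneg_right ?_ (Nat.cast_nonneg _)
  exact_mod_cast card_le_card (fun A hA => by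
    rw [mem_filter] at hA ⊢; exact ⟨hA.1, h A hA.2⟩)

/-- Difference bound: `Pr_A[P] ≤ Pr_A[Q] + Pr_A[P ∧ ¬Q]`. [folklore] -/
theorem kSubsetProb_le_add {k : ℕ} (P Q : Finset (Fin n) → Prop) [DecidablePred P] [DecidablePred Q] :
    kSubsetProb n k P ≤ kSubsetProb n k Q + kSubsetProb n k fun A => P A ∧ ¬ Q A := by
  unfold kSubsetProb
  rw [← add_div]
  refine div_le_div_of_nonneg_right ?_ (Nat.cast_nonneg _)
  have : (powersetCard k (univ : Finset (Fin n))).filter P ⊆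
      (powersetCard k univ).filter Q ∪ (powersetCard k univ).filter fun A => P A ∧ ¬ Q A := by
    intro A hA
    rw [mem_filter] at hA
    rw [mem_union, mem_filter, mem_filter]
    by_cases hQ : Q A
    · exact Or.inl ⟨hA.1, hQ⟩
    · exact Or.inr ⟨hA.1, hA.2, hQ⟩
  exact_mod_cast (card_le_card this).trans (card_union_le _ _)

/-- `Pr_A[P] = #{A : P A} / C(n,k)` as a bound: `#{A : P A} ≤ C(n,k) · x ⇒ Pr ≤ x`. [folklore] -/
theorem kSubsetProb_le_of_card_le {k : ℕ} (hkn : k ≤ n) (P : Finset (Fin n) → Prop) [DecidablePred P]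
    {x : ℝ} (h : (#((powersetCard k (univ : Finset (Fin n))).filter P) : ℝ) ≤ n.choose k * x) :
    kSubsetProb n k P ≤ x := by
  unfold kSubsetProb
  have hpos : (0 : ℝ) < n.choose k := by exact_mod_cast Nat.choose_pos hkn
  rw [div_le_iff₀ hpos]
  linarith

/-- Lower bound transfer: `x ≤ Pr_A[P] ⇒ C(n,k) · x ≤ #{A : P A}`. [folklore] -/
theorem card_ge_of_le_kSubsetProb {k : ℕ} (hkn : k ≤ n) (P : Finset (Fin n) → Prop)
    [DecidablePred P] {x : ℝ} (h : x ≤ kSubsetProb n k P) :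
    (n.choose k : ℝ) * x ≤ #((powersetCard k (univ : Finset (Fin n))).filter P) := by
  unfold kSubsetProb at h
  have hpos : (0 : ℝ) < n.choose k := by exact_mod_cast Nat.choose_pos hkn
  rw [le_div_iff₀ hpos] at h
  linarith

/-- Supersets of a `v`-set among the `k`-sets: at most `C(n - v, k - v)`. [folklore] -/
theorem card_filter_supset_le {k : ℕ} (S : Finset (Fin n)) :
    #((powersetCard k (univ : Finset (Fin n))).filter fun A => S ⊆ A) ≤ (n - #S).choose (k - #S) := by
  have : #((univ \ S).powersetCard (k - #S)) = (n - #S).choose (k - #S) := by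
    rw [card_powersetCard, card_sdiff_of_subset (subset_univ S), card_univ, Fintype.card_fin]
  rw [← this]
  refine card_le_card_of_injOn (fun A => A \ S) (fun A hA => ?_) (fun A hA B hB (hAB : A \ S = B \ S) => ?_)
  · rw [mem_coe, mem_filter, mem_powersetCard] at hA
    rw [mem_coe, mem_powersetCard]
    exact ⟨sdiff_subset_sdiff (subset_univ _) Subset.rfl, by rw [card_sdiff_of_subset hA.2, hA.1.2]⟩
  · rw [mem_coe, mem_filter] at hA hB
    rw [← sdiff_union_of_subset hA.2, ← sdiff_union_of_subset hB.2, hAB]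

/-- The binomial inequality `C(n-v, k-v) · n^v ≤ k^v · C(n,k)` (`v ≤ k ≤ n`), i.e.
`Pr_A[S ⊆ A] ≤ (k/n)^{|S|}`. [folklore] -/
theorem choose_sub_mul_pow_le_pow_mul_choose : ∀ (v n k : ℕ), v ≤ k → k ≤ n →
    (n - v).choose (k - v) * n ^ v ≤ k ^ v * n.choose k := by
  intro v
  induction v with
  | zero => intro n k _ _; simp
  | succ v ih =>
    intro n k hvk hkn
    have ih' := ih n k (by omega) hkn
    have hstep : (n - v) * ((n - (v + 1)).choose (k - (v + 1))) = (n - v).choose (k - v) * (k - v) := by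
      have := Nat.add_one_mul_choose_eq (n - v - 1) (k - v - 1)
      rw [show n - v - 1 + 1 = n - v by omega, show k - v - 1 + 1 = k - v by omega] at this
      rw [show n - (v + 1) = n - v - 1 by omega, show k - (v + 1) = k - v - 1 by omega]
      exact this
    have hnv : 0 < n - v := by omega
    refine Nat.le_of_mul_le_mul_left ?_ hnv
    calc (n - v) * ((n - (v + 1)).choose (k - (v + 1)) * n ^ (v + 1))
        = (k - v) * n * ((n - v).choose (k - v) * n ^ v) := by rw [← mul_assoc, hstep]; ring
      _ ≤ (k - v) * n * (k ^ v * n.choose k) := Nat.mul_le_mul_left _ ih'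
      _ ≤ k * (n - v) * (k ^ v * n.choose k) := by
          refine Nat.mul_le_mul_right _ ?_
          have hvk' : v ≤ k := by omega
          have hvn : v ≤ n := by omega
          zify [hvk', hvn]
          zify at hvk hkn
          nlinarith
      _ = (n - v) * (k ^ (v + 1) * n.choose k) := by ring

/-- **`Pr_A[S ⊆ A] ≤ (k/n)^{|S|}`** for the uniformly random `k`-subset `A` of `[n]`, `|S| ≤ k ≤ n`
(Rossman 2010, proof of Lemma 16: "each graph isomorphic to `Fᵢ` belongs to `S(K_A)` for
`O(n^{k - supp(Fᵢ)})` different `A`"). [cite: Rossman2010, Lemma 16 (p. 9)] -/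
theorem kSubsetProb_supset_le {k : ℕ} (hkn : k ≤ n) (hn : 0 < n) (S : Finset (Fin n)) (hS : #S ≤ k) :
    kSubsetProb n k (fun A => S ⊆ A) ≤ ((k : ℝ) / n) ^ #S := by
  refine kSubsetProb_le_of_card_le hkn _ ?_
  have h1 := card_filter_supset_le (k := k) S
  have h2 := choose_sub_mul_pow_le_pow_mul_choose #S n k hS hkn
  have hnpos : (0 : ℝ) < (n : ℝ) ^ #S := by positivity
  rw [div_pow, mul_div_assoc', le_div_iff₀ hnpos]
  calc (#((powersetCard k (univ : Finset (Fin n))).filter fun A => S ⊆ A) : ℝ) * (n : ℝ) ^ #S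
      ≤ (n - #S).choose (k - #S) * (n : ℝ) ^ #S := by
        exact mul_le_mul_of_nonneg_right (by exact_mod_cast h1) hnpos.le
    _ ≤ (k : ℝ) ^ #S * n.choose k := by exact_mod_cast h2
    _ = n.choose k * (k : ℝ) ^ #S := by ring

/-! ### Bridge to `gnpProb` -/

/-- `gnpWeight = pw` (same product weight). [folklore] -/
theorem gnpWeight_eq_pw (p : ℝ) (x : (⊤ : SimpleGraph (Fin n)).edgeSet → Bool) :
    gnpWeight n p x = pw p x := by
  rw [gnpWeight, pw_eq, card_edgeSet_top_fin]; rfl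

/-- **`gnpProb` is `prob`**: `Pr[G(n,p) ∈ {x | P x}] = prob p P`. [folklore] -/
theorem gnpProb_filter_eq_prob (p : ℝ) (P : ((⊤ : SimpleGraph (Fin n)).edgeSet → Bool) → Prop)
    [DecidablePred P] : gnpProb n p (univ.filter P) = prob p P := by
  rw [prob_eq, gnpProb]
  exact sum_congr rfl fun x _ => gnpWeight_eq_pw p x

end Literature.Computability.Complexity

/-!
## Exponent bookkeeping for Rossman 2010, Theorem 1

The constants of the proof of Theorem 1 (Rossman 2010, §3 and §6) as functions of `k ≥ 5` and
`0 < δ ≤ k⁻³`, and the elementary real inequalities between exponents of `n` that drive the two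
halves of the proof:

* `pMinus k δ n = n^{-2(1+δ)/(k-1)}` (`p⁻`, §3), `tThr δ n = exp(-n^δ)` (the closedness
  threshold `e^{-n^δ}` of Definition 8);
* `slack k δ = min (1 - δ(k-2)) (2/(k-1) - δk) > 0` (`slack_pos`) — the room in the exponent
  comparisons "`p⁻` is supercritical for `k`-cliques minus an edge and all their subgraphs"
  (Lemma 15: "for any small enough `δ` so that `p⁻(n)` is supercritical for the existence of
  `k`-cliques minus an edge");
* `cExp = slack/(4k²)` (the `Ω(1)` in `1 - exp(-n^{Ω(1)})` before the final halving),
  `cPrime = min(cExp, δ)/2` (the exponent `c'` of the conclusion), `kappa = δ + 2(1+δ)/(k-1)`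
  (Lemma 9: `(B log(s/t)/p⁻)^s ≤ (2B)^s n^{κ s}`), `kappaP = 2(1+δ)/(k-1) + 2 cExp`;
* `kappaP_mul_add_le` — `κ'·z + slack/2 ≤ v` for the edge sets `Z` (`z` edges on `v` vertices)
  inside a `k`-clique minus an edge (spreadness in Lemma 15);
* `kappa_mul_sub_le` — `κ·s - v ≤ -(k/4 + 1/8)` for the signatures `(v, s)` of graphs in `J`
  (the final count, end of §6: `sup(H) - |E_H|(2/(k-1) + 2δ) > k/4`).

## References

* B. Rossman, *The monotone complexity of k-clique on random graphs*, FOCS 2010 (full version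
  2009), §3 (p. 4), Lemma 15 and end of §6 (p. 9) [Rossman2010].
-/

noncomputable section

namespace Literature.Computability.Complexity

open Real

/-- `p⁻(n) = n^{-2(1+δ)/(k-1)}`, the subcritical edge density of Rossman 2010, §3 (written
exactly as in `Rossman2010Thm1At`). [cite: Rossman2010, §3 (p. 4)] -/
def pMinus (k : ℕ) (δ : ℝ) (n : ℕ) : ℝ := (n : ℝ) ^ (-(2 * (1 + δ)) / ((k : ℝ) - 1))

/-- `t(n) = e^{-n^δ}`, the threshold in the definition of ⋆-closed functions (Rossman 2010,
Definition 8). [cite: Rossman2010, Definition 8 (p. 6)] -/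
def tThr (δ : ℝ) (n : ℕ) : ℝ := exp (-((n : ℝ) ^ δ))

/-- The exponent slack `min (1 - δ(k-2)) (2/(k-1) - δk)`. [cite: Rossman2010, Lemma 15 (p. 9)] -/
def slack (k : ℕ) (δ : ℝ) : ℝ := min (1 - δ * ((k : ℝ) - 2)) (2 / ((k : ℝ) - 1) - δ * k)

/-- The exponent `c = slack/(4k²)` of the spread-lemma error `ε = e^{-n^c}` in Lemma 15.
[cite: Rossman2010, Lemma 15 (p. 9)] -/
def cExp (k : ℕ) (δ : ℝ) : ℝ := slack k δ / (4 * (k : ℝ) ^ 2)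

/-- The exponent `c' = min(c, δ)/2` of the conclusion `E[C(G⁻)] ≥ 1 - exp(-n^{c'})`.
[cite: Rossman2010, Thm 1 (p. 4)] -/
def cPrime (k : ℕ) (δ : ℝ) : ℝ := min (cExp k δ) δ / 2

/-- `κ = δ + 2(1+δ)/(k-1)`: `(B log(s/t)/p⁻) ≤ 2B n^κ` (Lemma 9's bound
`n^{s(2/(k-1) + 2δ)}`). [cite: Rossman2010, Lemma 9 (p. 7)] -/
def kappa (k : ℕ) (δ : ℝ) : ℝ := δ + 2 * (1 + δ) / ((k : ℝ) - 1)

/-- `κ' = 2(1+δ)/(k-1) + 2c`: the spread parameter of Lemma 15 is `≤ n^{κ'}`.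
[cite: Rossman2010, Lemma 15 (p. 9)] -/
def kappaP (k : ℕ) (δ : ℝ) : ℝ := 2 * (1 + δ) / ((k : ℝ) - 1) + 2 * cExp k δ

section

variable {k : ℕ} {δ : ℝ}

/-- `δ ≤ k⁻³` in product form. [folklore] -/
theorem delta_mul_cube_le_one (hk : 5 ≤ k) (hδ1 : δ ≤ 1 / (k : ℝ) ^ 3) : δ * (k : ℝ) ^ 3 ≤ 1 := by
  have hk0 : (0 : ℝ) < (k : ℝ) ^ 3 := by positivity
  rwa [le_div_iff₀ hk0] at hδ1

/-- **The slack is positive** for `k ≥ 5`, `0 < δ ≤ k⁻³`. [cite: Rossman2010, Lemma 15 (p. 9)] -/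
theorem slack_pos (hk : 5 ≤ k) (hδ0 : 0 < δ) (hδ1 : δ ≤ 1 / (k : ℝ) ^ 3) : 0 < slack k δ := by
  have hk' : (5 : ℝ) ≤ k := by exact_mod_cast hk
  have h1 := delta_mul_cube_le_one hk hδ1
  refine lt_min ?_ ?_
  · nlinarith [mul_pos hδ0 (by positivity : (0 : ℝ) < (k : ℝ) ^ 2)]
  · rw [sub_pos, lt_div_iff₀ (by linarith)]
    nlinarith [mul_pos hδ0 (by positivity : (0 : ℝ) < (k : ℝ))]

/-- `slack ≤ 1`. [folklore] -/
theorem slack_le_one (hk : 5 ≤ k) (hδ0 : 0 < δ) : slack k δ ≤ 1 := by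
  have hk' : (5 : ℝ) ≤ k := by exact_mod_cast hk
  refine (min_le_left _ _).trans ?_
  nlinarith

/-- `0 < cExp`. [folklore] -/
theorem cExp_pos (hk : 5 ≤ k) (hδ0 : 0 < δ) (hδ1 : δ ≤ 1 / (k : ℝ) ^ 3) : 0 < cExp k δ := by
  unfold cExp
  have := slack_pos hk hδ0 hδ1
  positivity

/-- `0 < cPrime`. [folklore] -/
theorem cPrime_pos (hk : 5 ≤ k) (hδ0 : 0 < δ) (hδ1 : δ ≤ 1 / (k : ℝ) ^ 3) : 0 < cPrime k δ := by
  unfold cPrime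
  have := cExp_pos hk hδ0 hδ1
  exact div_pos (lt_min this hδ0) two_pos

/-- `cPrime < cExp` and `cPrime < δ`. [folklore] -/
theorem cPrime_lt (hk : 5 ≤ k) (hδ0 : 0 < δ) (hδ1 : δ ≤ 1 / (k : ℝ) ^ 3) :
    cPrime k δ < cExp k δ ∧ cPrime k δ < δ := by
  unfold cPrime
  have := cExp_pos hk hδ0 hδ1
  constructor
  · have := min_le_left (cExp k δ) δ; linarith [lt_min (cExp_pos hk hδ0 hδ1) hδ0]
  · have := min_le_right (cExp k δ) δ; linarith [lt_min (cExp_pos hk hδ0 hδ1) hδ0]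

/-- `0 < kappaP`. [folklore] -/
theorem kappaP_pos (hk : 5 ≤ k) (hδ0 : 0 < δ) (hδ1 : δ ≤ 1 / (k : ℝ) ^ 3) : 0 < kappaP k δ := by
  unfold kappaP
  have hk' : (5 : ℝ) ≤ k := by exact_mod_cast hk
  have := cExp_pos hk hδ0 hδ1
  have : 0 < 2 * (1 + δ) / ((k : ℝ) - 1) := div_pos (by linarith) (by linarith)
  linarith

/-- `2 c z ≤ slack/4` for `z ≤ k²/2` edges. [folklore] -/
theorem two_mul_cExp_mul_le (hk : 5 ≤ k) (hδ0 : 0 < δ) (hδ1 : δ ≤ 1 / (k : ℝ) ^ 3) {z : ℝ}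
    (hz : 2 * z ≤ (k : ℝ) ^ 2) : 2 * cExp k δ * z ≤ slack k δ / 4 := by
  unfold cExp
  have hs := slack_pos hk hδ0 hδ1
  have hk2 : (0 : ℝ) < (k : ℝ) ^ 2 := by positivity
  rw [show 2 * (slack k δ / (4 * (k : ℝ) ^ 2)) * z = slack k δ * (2 * z) / (4 * (k : ℝ) ^ 2) by ring,
    div_le_div_iff₀ (by positivity) (by norm_num)]
  nlinarith [mul_le_mul_of_nonneg_left hz hs.le]

/-- `C(v,2) ≤ v²/2 ≤ k²/2`-type bound: `2·C(v,2) ≤ k²` for `v ≤ k`. [folklore] -/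
theorem two_mul_choose_two_le_sq {v k : ℕ} (hv : v ≤ k) : 2 * (v.choose 2 : ℝ) ≤ (k : ℝ) ^ 2 := by
  have h := two_mul_choose_two_add v
  have h' : (2 * v.choose 2 : ℕ) ≤ k * k := by nlinarith
  have : ((2 * v.choose 2 : ℕ) : ℝ) ≤ ((k * k : ℕ) : ℝ) := by exact_mod_cast h'
  push_cast at this
  linarith

/-- **Exponent comparison for Lemma 15** (supercriticality of `p⁻` for cliques minus an edge and
their subgraphs): for an edge set with `z ≥ 1` edges on `v` vertices inside a `k`-clique minus an
edge — so `2 ≤ v ≤ k`, `z ≤ C(v,2)`, and `z ≤ C(k,2) - 1` — one has `κ'·z + slack/2 ≤ v`.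
[cite: Rossman2010, Lemma 15 (p. 9)] -/
theorem kappaP_mul_add_le (hk : 5 ≤ k) (hδ0 : 0 < δ) (hδ1 : δ ≤ 1 / (k : ℝ) ^ 3) {v z : ℕ}
    (hv2 : 2 ≤ v) (hvk : v ≤ k) (hzv : z ≤ v.choose 2) (hzk : z + 1 ≤ k.choose 2) :
    kappaP k δ * z + slack k δ / 2 ≤ v := by
  have hk' : (5 : ℝ) ≤ k := by exact_mod_cast hk
  have hkm1 : (0 : ℝ) < (k : ℝ) - 1 := by linarith
  have hcube := delta_mul_cube_le_one hk hδ1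
  have hs := slack_pos hk hδ0 hδ1
  have hz2 : 2 * (z : ℝ) ≤ (k : ℝ) ^ 2 :=
    le_trans (by exact_mod_cast Nat.mul_le_mul_left 2 hzv) (two_mul_choose_two_le_sq hvk)
  have hc := two_mul_cExp_mul_le hk hδ0 hδ1 hz2
  -- the main term: `(2(1+δ)/(k-1)) z ≤ v - slack`
  have hmain : 2 * (1 + δ) / ((k : ℝ) - 1) * z ≤ v - slack k δ := by
    rw [div_mul_eq_mul_div, div_le_iff₀ hkm1]
    rcases Nat.lt_or_ge v k with hlt | hge
    · -- `v ≤ k - 1`, `z ≤ C(v,2)`: slack ≤ 1 - δ(k-2)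
      have hsl : slack k δ ≤ 1 - δ * ((k : ℝ) - 2) := min_le_left _ _
      have hcz := two_mul_choose_two_add v
      have hz' : 2 * (z : ℝ) ≤ (v : ℝ) * v - v := by
        have : ((2 * z : ℕ) : ℝ) ≤ ((v * v - v : ℕ) : ℝ) := by exact_mod_cast (by omega : 2 * z ≤ v * v - v)
        have hvv : v ≤ v * v := Nat.le_mul_self v
        push_cast [hvv] at this
        linarith
      have hvk1 : (v : ℝ) ≤ (k : ℝ) - 1 := by
        have : v + 1 ≤ k := hlt
        have : ((v + 1 : ℕ) : ℝ) ≤ k := by exact_mod_cast this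
        push_cast at this; linarith
      have hv2' : (2 : ℝ) ≤ v := by exact_mod_cast hv2
      -- (v-1)((k-1) - (1+δ)v) + δ(k-2)(k-1) ≥ 0
      rcases lt_or_eq_of_le hvk1 with hlt' | heq
      · have hvk2 : (v : ℝ) ≤ (k : ℝ) - 2 := by
          have : v + 2 ≤ k := by
            by_contra h
            have : (k : ℝ) - 1 ≤ v := by
              have : k ≤ v + 1 := by omega
              have : ((k : ℕ) : ℝ) ≤ ((v + 1 : ℕ) : ℝ) := by exact_mod_cast this
              push_cast at this; linarith
            linarith
          have : ((v + 2 : ℕ) : ℝ) ≤ k := by exact_mod_cast this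
          push_cast at this; linarith
        have hpos : 0 ≤ ((k : ℝ) - 1) - (1 + δ) * v := by nlinarith
        nlinarith [mul_nonneg (by linarith : (0 : ℝ) ≤ v - 1) hpos, mul_nonneg hδ0.le (by linarith : (0:ℝ) ≤ (k:ℝ) - 2)]
      · rw [heq] at hz' ⊢
        nlinarith
    · -- `v = k`, `z ≤ C(k,2) - 1`: slack ≤ 2/(k-1) - δk
      have hveq : v = k := le_antisymm hvk hge
      subst hveq
      have hsl : slack v δ ≤ 2 / ((v : ℝ) - 1) - δ * v := min_le_right _ _
      have hcz := two_mul_choose_two_add v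
      have hz' : 2 * (z : ℝ) + 2 ≤ (v : ℝ) * v - v := by
        have h1 : 2 * (z + 1) ≤ v * v - v := by omega
        have : ((2 * (z + 1) : ℕ) : ℝ) ≤ ((v * v - v : ℕ) : ℝ) := by exact_mod_cast h1
        have hvv : v ≤ v * v := Nat.le_mul_self v
        push_cast [hvv] at this
        linarith
      have hsl' : slack v δ * ((v : ℝ) - 1) ≤ 2 - δ * v * ((v : ℝ) - 1) := by
        have := mul_le_mul_of_nonneg_right hsl hkm1.le
        rwa [sub_mul, div_mul_cancel₀ _ hkm1.ne'] at this
      nlinarith [mul_pos hδ0 (by linarith : (0 : ℝ) < v)]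
  unfold kappaP
  nlinarith

/-- **Exponent comparison for the final count** (end of §6): for the signature `(v, s)` of a
graph in `J` — `1 ≤ s ≤ C(v,2)`, `v + 1 ≤ k`, `k² + 7 + 8s + 4v ≤ 4kv` (`medJ_ineq`) — one has
`κ·s - v ≤ -(k/4 + 1/8)`. [cite: Rossman2010, §6 (p. 9)] -/
theorem kappa_mul_sub_le (hk : 5 ≤ k) (hδ0 : 0 < δ) (hδ1 : δ ≤ 1 / (k : ℝ) ^ 3) {v s : ℕ}
    (hsv : s ≤ v.choose 2) (hvk : v + 1 ≤ k) (hJ : k ^ 2 + 7 + 8 * s + 4 * v ≤ 4 * k * v) :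
    kappa k δ * s - v ≤ -((k : ℝ) / 4 + 1 / 8) := by
  have hk' : (5 : ℝ) ≤ k := by exact_mod_cast hk
  have hkm1 : (0 : ℝ) < (k : ℝ) - 1 := by linarith
  have hcube := delta_mul_cube_le_one hk hδ1
  have hJ' : ((k ^ 2 + 7 + 8 * s + 4 * v : ℕ) : ℝ) ≤ ((4 * k * v : ℕ) : ℝ) := by exact_mod_cast hJ
  push_cast at hJ'
  have hs2 : 2 * (s : ℝ) ≤ (k : ℝ) ^ 2 :=
    le_trans (by exact_mod_cast Nat.mul_le_mul_left 2 hsv) (two_mul_choose_two_le_sq (by omega))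
  -- δ s (k+1) ≤ 1
  have hds : δ * s * ((k : ℝ) + 1) ≤ 1 := by
    have h1 : δ * s * ((k : ℝ) + 1) ≤ δ * ((k : ℝ) ^ 2 / 2) * ((k : ℝ) + 1) := by
      have : (s : ℝ) ≤ (k : ℝ) ^ 2 / 2 := by linarith
      have hk1 : (0 : ℝ) ≤ (k : ℝ) + 1 := by linarith
      nlinarith [mul_le_mul_of_nonneg_left this hδ0.le]
    have h2 : δ * ((k : ℝ) ^ 2 / 2) * ((k : ℝ) + 1) ≤ 1 := by
      have : (k : ℝ) ^ 2 * ((k : ℝ) + 1) ≤ 2 * (k : ℝ) ^ 3 := by nlinarith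
      nlinarith [mul_le_mul_of_nonneg_left this hδ0.le]
    linarith
  unfold kappa
  rw [show (δ + 2 * (1 + δ) / ((k : ℝ) - 1)) * s - v =
      ((δ * s * ((k : ℝ) - 1) + 2 * (1 + δ) * s) - v * ((k : ℝ) - 1)) / ((k : ℝ) - 1) by
    field_simp]
  rw [div_le_iff₀ hkm1]
  nlinarith [mul_pos hδ0 (by positivity : (0 : ℝ) < s + 1)]

end

end Literature.Computability.Complexity
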